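/-
Copyright (c) 2026. All rights reserved.
Released under Apache 2.0 license as described in the file LICENSE.
Authors: abc-iut cell, prover seat abc-iut-w4-d095 (gen 7; row «SB′-CONTACT», abc-iut-L4-lead m136), over abc-iut-f-101's
frames of the telecore diagram (`LogFrobeniusMonoTelecoreFrames/FrameIsos/FrameLifts/Postcomp`, `DiagramRelativeFamilies`) and
this seat's `LogFrobeniusObservablesCoreChains` (nothing of those files is restated).
-/
import Literature.AnabelianGeometry.AbsoluteAnabelian.LogFrobeniusMonoTelecoreContact
import Literature.AnabelianGeometry.AbsoluteAnabelian.LogFrobeniusObservablesCoreChains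
import HarnessLib

/-!
# [AbsTopIII] Cor 5.10 (iv)(c): the relative lifts at the vertices `𝒩⊞_v` of the telecore diagram `D_{An⊢}` — the `ι⊞`-pairs of `S_log⊞`

S. Mochizuki, *Topics in absolute anabelian geometry III: global reconstruction algorithms*,
J. Math. Sci. Univ. Tokyo 22 (2015) 939–1156 [MochizukiAbsTopIII2015]; manuscript `paper:url-5493eb38cbb7`: Cor 5.10
(iv)(c) p. 148 ("[the contact structure `ℋ_{An⊢}`] is compatible … with the homotopies of the observables `S_log`, `S_log⊞` of
Corollary 5.5, (iii), that arise from the `ι⊞_{v,ε}`, `ι_{v,ε}` indexed by `ε ∈ Γ⃗×_v` [not `Γ⃗^log_v`!]"), Cor 5.5 (iii) p. 131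
(`S_log⊞`: the pair `([λ⊞_{v,ν₁}], [λ⊞_{v,ν₂}])` of paths `□ → 𝒩⊞_v` with homotopy `ι⊞_{v,ε}`), Def 3.5 (ii) p. 75 / §0 p. 26
(saturation: pre- and post-composition, transitivity), Rmk 3.5.1 p. 78 (homotopies over the "constant portion").

WHY THIS FILE (row «SB′-CONTACT», brick C₁ (first half: the relation; the homotopies are in `LogFrobeniusMonoTelecoreLamLiftsTheta`); PROOF-SIDE, nothing of the interface restated).  Inside the telecore diagram
`D_{An⊢}` (abc-iut-f-101's `monoTeleDiagram`) the observable pairs of `S_log⊞` indexed by `Γ⃗×_v` are the pairs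
`([λ⊞_{v,ν₁}]∘[ρ], [λ⊞_{v,ν₂}]∘[ρ])` into the vertex `𝒩⊞_v` (common prefix `[ρ]` into `□`), and transitivity forces the pairs
with `ν₁ ⤳ ν₂` merely REACHABLE, homotopy `ι⊞` along the chain (`lamChain`).  This file packages them as a relative-lift datum
in the sense of abc-iut-f-101's `DiagramRelativeFamilies` at the vertex set `{𝒩⊞_v}`:

* `NWit`, `NRelN` — the related pairs at `𝒩⊞_v` (witness: prefix `R`; parameters: vertices `ν₁ ⤳ ν₂` of `Γ⃗×_v`); the witness
  is unique and the vertices are determined by the paths (`NWit.eq_of`, `NWit.ν_eq_left/right`); `NW`, `NRel` — the vertex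
  set `{𝒩⊞_v}` and the vertex-indexed relation (none elsewhere);
* `eq_nil_of_path_nplus` — no non-trivial path of `Γ⃗_{D_{An⊢}}` runs between two vertices `𝒩⊞_v`, `𝒩⊞_{v′}` (bookkeeping);
* `lamChainD` — `ι⊞` along a chain read between the DIAGRAM's functors `D_{An⊢}(λ⊞_{v,ν})` (bookkeeping: same term, the
  diagram's instances); `θN` — the homotopy `𝒟_[ρ] ◁ (ι⊞ along ν₁ ⤳ ν₂)` of a related pair, with the four laws of Def 3.5 (ii):
  `θN_self`, `θN_trans` (UNDER the `ι⊞`-square `IotaCoreSquaresCommute`, which any observable structure `S_log⊞` supplies),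
  `θN_precomp_heq`, `θN_postcomp_heq` (trivial: only empty paths stay inside `{𝒩⊞_v}`); ★ `lamRelLifts` — the resulting
  `RelLifts` datum;
* `θN_over` — GIVEN abc-iut-L4-t3's `IotaOver`, the homotopies `θN` LIE OVER the structure isomorphisms of abc-iut-f-101's
  `monoTeleOver` (Rmk 3.5.1) — the input of the cross post-composition law into the core vertex (lift uniqueness) and into
  `𝒩⊢⊞_{v′}` (brick C₂, `LogFrobeniusMonoTelecoreContactObservables`);
* `nrelN_lamE` — the core-edge generator pair `([λ⊞_{v,ν₁}], [λ⊞_{v,ν₂}])` itself is related, homotopy the untwisted `ι⊞_{v,ε}`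
  (`θN_lamE_app_heq`).

Refereed pre-IUT material; OUR constructions over a typed interface and its typed add-ons; nothing here bears on [IUTchIII]
Cor. 3.12; no side taken; typed ≠ proved.
-/

set_option autoImplicit false

universe u

open CategoryTheory Quiver

namespace Literature.AnabelianGeometry.AbsoluteAnabelian

namespace LogFrobeniusSetting

variable {Vmod : Type u} {isArc : Vmod → Bool}

/-! ## The related pairs at `𝒩⊞_v` -/

/-- WITNESS that a co-verticial pair of paths into `𝒩⊞_v` consists of `[λ⊞_{v,ν₁}]∘[ρ]` and `[λ⊞_{v,ν₂}]∘[ρ]` for a common prefix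
`[ρ]` into `□` (Cor 5.5 (iii): the pairs `([λ⊞_{v,ν₁}], [λ⊞_{v,ν₂}])` of `S_log⊞`, pre-composed, §0 (d)).
[cite: MochizukiAbsTopIII2015, Cor 5.5 (iii) p. 131] -/
structure NWit (v : Vmod) (ν₁ ν₂ : LogVertex (isArc v)) (hν₁ : ν₁.IsCross) (hν₂ : ν₂.IsCross)
    {a : (monoTeleShape Vmod isArc).Vertex} (p q : Path a (nplusVx (isArc := isArc) v)) where
  /-- the common prefix into `□` -/
  R : Path a (boxVx Vmod isArc)
  left_eq : p = R.cons (lamE v ν₁ hν₁)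
  right_eq : q = R.cons (lamE v ν₂ hν₂)

namespace NWit

variable {v : Vmod} {a : (monoTeleShape Vmod isArc).Vertex}

/-- the last arrow of a path `[λ⊞_{v,ν}]∘[ρ]` determines `ν`. [cite: MochizukiAbsTopIII2015, Cor 5.5 (iii) p. 131] -/
theorem ν_eq_of_cons_eq {R R' : Path a (boxVx Vmod isArc)} {ν ν' : LogVertex (isArc v)} {hν : ν.IsCross} {hν' : ν'.IsCross}
    (h : R.cons (lamE v ν hν) = R'.cons (lamE v ν' hν')) : ν = ν' := by
  have h' : (DEdge.lam v ν hν.1 : DEdge isArc .core (.nplus v)) = DEdge.lam v ν' hν'.1 :=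
    eq_of_heq (Path.hom_heq_of_cons_eq_cons h)
  cases h'
  rfl

/-- … and the prefix `[ρ]`. [cite: MochizukiAbsTopIII2015, Cor 5.5 (iii) p. 131] -/
theorem R_eq_of_cons_eq {R R' : Path a (boxVx Vmod isArc)} {ν ν' : LogVertex (isArc v)} {hν : ν.IsCross} {hν' : ν'.IsCross}
    (h : R.cons (lamE v ν hν) = R'.cons (lamE v ν' hν')) : R = R' :=
  eq_of_heq (Path.heq_of_cons_eq_cons h)

variable {ν₁ ν₂ ν₁' ν₂' : LogVertex (isArc v)} {hν₁ : ν₁.IsCross} {hν₂ : ν₂.IsCross} {hν₁' : ν₁'.IsCross} {hν₂' : ν₂'.IsCross}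
  {p q : Path a (nplusVx (isArc := isArc) v)}

/-- the left vertex is determined by the left path. [cite: MochizukiAbsTopIII2015, Cor 5.5 (iii) p. 131] -/
theorem ν_eq_left {q' : Path a (nplusVx (isArc := isArc) v)} (w : NWit v ν₁ ν₂ hν₁ hν₂ p q)
    (w' : NWit v ν₁' ν₂' hν₁' hν₂' p q') : ν₁ = ν₁' :=
  ν_eq_of_cons_eq (w.left_eq.symm.trans w'.left_eq)

/-- the right vertex is determined by the right path. [cite: MochizukiAbsTopIII2015, Cor 5.5 (iii) p. 131] -/
theorem ν_eq_right {p' : Path a (nplusVx (isArc := isArc) v)} (w : NWit v ν₁ ν₂ hν₁ hν₂ p q)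
    (w' : NWit v ν₁' ν₂' hν₁' hν₂' p' q) : ν₂ = ν₂' :=
  ν_eq_of_cons_eq (w.right_eq.symm.trans w'.right_eq)

/-- the middle vertex of two consecutive pairs is determined. [cite: MochizukiAbsTopIII2015, Cor 5.5 (iii) p. 131] -/
theorem ν_eq_mid {r : Path a (nplusVx (isArc := isArc) v)} (w : NWit v ν₁ ν₂ hν₁ hν₂ p q)
    (w' : NWit v ν₁' ν₂' hν₁' hν₂' q r) : ν₂ = ν₁' :=
  ν_eq_of_cons_eq (w.right_eq.symm.trans w'.left_eq)

/-- **the witness is unique** (a path into `𝒩⊞_v` determines its prefix). [cite: MochizukiAbsTopIII2015, Cor 5.5 (iii) p. 131] -/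
theorem eq_of (w w' : NWit v ν₁ ν₂ hν₁ hν₂ p q) : w = w' := by
  obtain ⟨R, hl, hr⟩ := w
  obtain ⟨R', hl', hr'⟩ := w'
  obtain rfl : R = R' := R_eq_of_cons_eq (hl.symm.trans hl')
  rfl

/-- the diagonal witness of the left path. [cite: MochizukiAbsTopIII2015, Section 0 p.26] -/
def reflLeft (w : NWit v ν₁ ν₂ hν₁ hν₂ p q) : NWit v ν₁ ν₁ hν₁ hν₁ p p := ⟨w.R, w.left_eq, w.left_eq⟩

/-- the diagonal witness of the right path. [cite: MochizukiAbsTopIII2015, Section 0 p.26] -/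
def reflRight (w : NWit v ν₁ ν₂ hν₁ hν₂ p q) : NWit v ν₂ ν₂ hν₂ hν₂ q q := ⟨w.R, w.right_eq, w.right_eq⟩

/-- the composite witness (§0 (c)). [cite: MochizukiAbsTopIII2015, Section 0 p.26] -/
def trans {ν₃ : LogVertex (isArc v)} {hν₃ : ν₃.IsCross} {r : Path a (nplusVx (isArc := isArc) v)}
    (w : NWit v ν₁ ν₂ hν₁ hν₂ p q) (w' : NWit v ν₂ ν₃ hν₂ hν₃ q r) : NWit v ν₁ ν₃ hν₁ hν₃ p r :=
  ⟨w.R, w.left_eq, (R_eq_of_cons_eq (w.right_eq.symm.trans w'.left_eq)) ▸ w'.right_eq⟩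

/-- the pre-composed witness (§0 (d)). [cite: MochizukiAbsTopIII2015, Section 0 p.26] -/
def precomp {c : (monoTeleShape Vmod isArc).Vertex} (r : Path c a) (w : NWit v ν₁ ν₂ hν₁ hν₂ p q) :
    NWit v ν₁ ν₂ hν₁ hν₂ (r.comp p) (r.comp q) :=
  ⟨r.comp w.R, by rw [← Path.comp_cons, ← w.left_eq], by rw [← Path.comp_cons, ← w.right_eq]⟩

end NWit

/-- **the related pairs at `𝒩⊞_v`**: the `ι⊞`-pairs of `S_log⊞` along the chains `ν₁ ⤳ ν₂` of `Γ⃗×_v` (after a common prefix).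
[cite: MochizukiAbsTopIII2015, Cor 5.5 (iii) p. 131] -/
def NRelN (v : Vmod) {a : (monoTeleShape Vmod isArc).Vertex} (p q : Path a (nplusVx (isArc := isArc) v)) : Prop :=
  ∃ (ν₁ ν₂ : LogVertex (isArc v)) (hν₁ : ν₁.IsCross) (hν₂ : ν₂.IsCross), ν₁.Reach ν₂ ∧ Nonempty (NWit v ν₁ ν₂ hν₁ hν₂ p q)

/-- a witnessed pair along a chain is related. [cite: MochizukiAbsTopIII2015, Cor 5.5 (iii) p. 131] -/
theorem nrelN_of_wit {v : Vmod} {a : (monoTeleShape Vmod isArc).Vertex} {ν₁ ν₂ : LogVertex (isArc v)} {hν₁ : ν₁.IsCross}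
    {hν₂ : ν₂.IsCross} {p q : Path a (nplusVx (isArc := isArc) v)} (w : NWit v ν₁ ν₂ hν₁ hν₂ p q) (h : ν₁.Reach ν₂) :
    NRelN v p q :=
  ⟨ν₁, ν₂, hν₁, hν₂, h, ⟨w⟩⟩

/-- the vertex set `{𝒩⊞_v : v ∈ V(F_mod)}` of the telecore graph. [cite: MochizukiAbsTopIII2015, Cor 5.10 (iv)(c) p.148] -/
def NW : (monoTeleShape Vmod isArc).Vertex → Prop
  | ExtVertex.base ⟨.nplus _, _⟩ => True
  | ExtVertex.base ⟨.row1 _, _⟩ => False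
  | ExtVertex.base ⟨.core, _⟩ => False
  | ExtVertex.base ⟨.nv _, _⟩ => False
  | ExtVertex.base ⟨.e5, _⟩ => False
  | ExtVertex.base ⟨.an, _⟩ => False
  | ExtVertex.base ⟨.e7, _⟩ => False
  | ExtVertex.base ⟨.nmonoPlus _, _⟩ => False
  | ExtVertex.base ⟨.nmono _, _⟩ => False
  | ExtVertex.base ⟨.emono5, _⟩ => False
  | ExtVertex.base ⟨.anMono, _⟩ => False
  | ExtVertex.base ⟨.emono7, _⟩ => False
  | ExtVertex.obs => False

/-- the vertex-indexed relation: `NRelN` at `𝒩⊞_v`, none at the other vertices.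
[cite: MochizukiAbsTopIII2015, Cor 5.10 (iv)(c) p.148] -/
def NRel : ∀ {a w : (monoTeleShape Vmod isArc).Vertex}, Path a w → Path a w → Prop
  | _, ExtVertex.base ⟨.nplus v, _⟩, p, q => NRelN v p q
  | _, ExtVertex.base ⟨.row1 _, _⟩, _, _ => False
  | _, ExtVertex.base ⟨.core, _⟩, _, _ => False
  | _, ExtVertex.base ⟨.nv _, _⟩, _, _ => False
  | _, ExtVertex.base ⟨.e5, _⟩, _, _ => False
  | _, ExtVertex.base ⟨.an, _⟩, _, _ => False
  | _, ExtVertex.base ⟨.e7, _⟩, _, _ => False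
  | _, ExtVertex.base ⟨.nmonoPlus _, _⟩, _, _ => False
  | _, ExtVertex.base ⟨.nmono _, _⟩, _, _ => False
  | _, ExtVertex.base ⟨.emono5, _⟩, _, _ => False
  | _, ExtVertex.base ⟨.anMono, _⟩, _, _ => False
  | _, ExtVertex.base ⟨.emono7, _⟩, _, _ => False
  | _, ExtVertex.obs, _, _ => False

section Vertices

variable {a : (monoTeleShape Vmod isArc).Vertex}

/-- `𝒩⊞_v` lies in the vertex set. [cite: MochizukiAbsTopIII2015, Cor 5.10 (iv)(c) p.148] -/
theorem nw_nplusVx (v : Vmod) : NW (nplusVx (isArc := isArc) v) := trivial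

/-- a vertex of the set is some `𝒩⊞_v`. [cite: MochizukiAbsTopIII2015, Cor 5.10 (iv)(c) p.148] -/
theorem eq_of_nw {w : (monoTeleShape Vmod isArc).Vertex} (hw : NW w) : ∃ v : Vmod, w = nplusVx v := by
  rcases w with ⟨b, hb⟩ | _
  · cases b <;> first | exact (hw : False).elim | exact ⟨_, rfl⟩
  · exact (hw : False).elim

/-- at `𝒩⊞_v` the relation is `NRelN`. [cite: MochizukiAbsTopIII2015, Cor 5.10 (iv)(c) p.148] -/
theorem nrel_nplus_iff {v : Vmod} (p q : Path a (nplusVx (isArc := isArc) v)) : NRel p q ↔ NRelN v p q := Iff.rfl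

/-- `𝒩⊞_v` is NOT in abc-iut-f-101's vertex set `W = {An⊢} ∪ {𝒩⊢⊞_v}` (the two data live on DISJOINT vertex sets).
[cite: MochizukiAbsTopIII2015, Cor 5.10 (iv)(c) p.148] -/
theorem not_mw_of_nw {w : (monoTeleShape Vmod isArc).Vertex} (hw : NW w) : ¬ MW w := by
  obtain ⟨v, rfl⟩ := eq_of_nw hw
  exact fun h => h

/-- the two vertex sets are disjoint. [cite: MochizukiAbsTopIII2015, Cor 5.10 (iv)(c) p.148] -/
theorem nw_mw_disjoint (w : (monoTeleShape Vmod isArc).Vertex) : NW w → MW w → False :=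
  fun hn hm => not_mw_of_nw hn hm

/-- `𝒩⊞_v` is a top vertex (abc-iut-f-101's `NotTop` fails there). [cite: MochizukiAbsTopIII2015, Cor 5.10 (iv)(b) p.147] -/
theorem not_notTop_of_nw {w : (monoTeleShape Vmod isArc).Vertex} (hw : NW w) : ¬ NotTop w := by
  obtain ⟨v, rfl⟩ := eq_of_nw hw
  exact fun h => h

/-- an arrow out of `𝒩⊞_v` ends at a `NotTop` vertex (`𝒩⊞_v → 𝒩_v`, `𝒩⊞_v → 𝒩⊢⊞_v`).
[cite: MochizukiAbsTopIII2015, Cor 5.10 (iv)(b) p.147] -/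
theorem notTop_of_hom_nplus {v : Vmod} {b : (monoTeleShape Vmod isArc).Vertex} (e : nplusVx (isArc := isArc) v ⟶ b) :
    NotTop b := by
  rcases b with ⟨b, hb⟩ | _
  · change DEdge isArc (.nplus v) b at e
    cases e <;> trivial
  · trivial

/-- a path out of `𝒩⊞_v` is empty or ends at a `NotTop` vertex. [cite: MochizukiAbsTopIII2015, Cor 5.10 (iv)(b) p.147] -/
theorem notTop_or_length_eq_zero_of_path_nplus {v : Vmod} {b : (monoTeleShape Vmod isArc).Vertex}
    (t : Path (nplusVx (isArc := isArc) v) b) : NotTop b ∨ t.length = 0 := by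
  induction t with
  | nil => exact Or.inr rfl
  | cons t e ih =>
    rcases ih with h | h
    · exact Or.inl (notTop_of_hom e h)
    · cases t with
      | nil => exact Or.inl (notTop_of_hom_nplus e)
      | cons _ _ => exact absurd h (Nat.succ_ne_zero _)

/-- **no non-trivial path of `Γ⃗_{D_{An⊢}}` runs between two vertices of `{𝒩⊞_v}`** (the arrows out of `𝒩⊞_v` lead to row 4 and
to the mono-analytic side, which never return). [cite: MochizukiAbsTopIII2015, Cor 5.10 (iv)(b) p.147] -/
theorem length_eq_zero_of_path_nplus {v : Vmod} {w : (monoTeleShape Vmod isArc).Vertex} (hw : NW w)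
    (t : Path (nplusVx (isArc := isArc) v) w) : t.length = 0 :=
  (notTop_or_length_eq_zero_of_path_nplus t).resolve_left (not_notTop_of_nw hw)

/-- a path from `𝒩⊞_v` to `𝒩⊞_v` is the empty path. [cite: MochizukiAbsTopIII2015, Cor 5.10 (iv)(b) p.147] -/
theorem eq_nil_of_path_nplus {v : Vmod} (t : Path (nplusVx (isArc := isArc) v) (nplusVx v)) : t = Path.nil :=
  Path.eq_nil_of_length_zero t (length_eq_zero_of_path_nplus (nw_nplusVx v) t)

end Vertices

/-! ## The relation is closed under the saturation moves -/

section Rel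

variable {a : (monoTeleShape Vmod isArc).Vertex}

/-- reflexive on the left member (§0 (a)). [cite: MochizukiAbsTopIII2015, Section 0 p.26] -/
theorem nrel_refl_left {w : (monoTeleShape Vmod isArc).Vertex} {p q : Path a w} (hw : NW w) (h : NRel p q) : NRel p p := by
  obtain ⟨v, rfl⟩ := eq_of_nw hw
  obtain ⟨ν₁, ν₂, hν₁, hν₂, -, ⟨wt⟩⟩ := h
  exact ⟨ν₁, ν₁, hν₁, hν₁, LogVertex.Reach.refl hν₁, ⟨wt.reflLeft⟩⟩

/-- reflexive on the right member (§0 (a)). [cite: MochizukiAbsTopIII2015, Section 0 p.26] -/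
theorem nrel_refl_right {w : (monoTeleShape Vmod isArc).Vertex} {p q : Path a w} (hw : NW w) (h : NRel p q) :
    NRel q q := by
  obtain ⟨v, rfl⟩ := eq_of_nw hw
  obtain ⟨ν₁, ν₂, hν₁, hν₂, -, ⟨wt⟩⟩ := h
  exact ⟨ν₂, ν₂, hν₂, hν₂, LogVertex.Reach.refl hν₂, ⟨wt.reflRight⟩⟩

/-- transitive (§0 (c); reachability is transitive). [cite: MochizukiAbsTopIII2015, Section 0 p.26] -/
theorem nrel_trans {w : (monoTeleShape Vmod isArc).Vertex} {p q r : Path a w} (hw : NW w) (h₁ : NRel p q) (h₂ : NRel q r) :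
    NRel p r := by
  obtain ⟨v, rfl⟩ := eq_of_nw hw
  obtain ⟨ν₁, ν₂, hν₁, hν₂, h12, ⟨w₁⟩⟩ := h₁
  obtain ⟨ν₂', ν₃, hν₂', hν₃, h23, ⟨w₂⟩⟩ := h₂
  obtain rfl : ν₂ = ν₂' := NWit.ν_eq_mid w₁ w₂
  exact ⟨ν₁, ν₃, hν₁, hν₃, LogVertex.Reach.trans h12 h23, ⟨w₁.trans w₂⟩⟩

/-- stable under pre-composition (§0 (d)). [cite: MochizukiAbsTopIII2015, Section 0 p.26] -/
theorem nrel_precomp {c w : (monoTeleShape Vmod isArc).Vertex} (r : Path c a) {p q : Path a w} (hw : NW w) (h : NRel p q) :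
    NRel (r.comp p) (r.comp q) := by
  obtain ⟨v, rfl⟩ := eq_of_nw hw
  obtain ⟨ν₁, ν₂, hν₁, hν₂, h12, ⟨wt⟩⟩ := h
  exact ⟨ν₁, ν₂, hν₁, hν₂, h12, ⟨wt.precomp r⟩⟩

/-- stable under post-composition INSIDE the vertex set (§0 (e)): only the empty path stays inside `{𝒩⊞_v}`.
[cite: MochizukiAbsTopIII2015, Section 0 p.26] -/
theorem nrel_postcomp {w w' : (monoTeleShape Vmod isArc).Vertex} {p q : Path a w} (t : Path w w') (hw : NW w) (hw' : NW w')
    (h : NRel p q) : NRel (p.comp t) (q.comp t) := by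
  obtain ⟨v, rfl⟩ := eq_of_nw hw
  have hl := length_eq_zero_of_path_nplus hw' t
  cases t with
  | nil => exact h
  | cons _ _ => exact absurd hl (Nat.succ_ne_zero _)

end Rel

end LogFrobeniusSetting

end Literature.AnabelianGeometry.AbsoluteAnabelian
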